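import Summits.Schanuel.Schanuel.Theorems.RootDecomp1KFiniteOrderCell02

/-!
# RootDecomp1KFiniteOrderCell — lens 1, generation 33 «33364 FIRST CELL» (RootDecomp1KFiniteOrderCell.lean 7ddcd064…, 1378 l) — continuation (RootDecomp1KFiniteOrderCell03): §4 a degree-n NON-MEASURE: the moment curve of `T_c` (c ≥ n + 1) is not hyper-Liouville as a linear form (`not_hyperLinLiouville_momentCurve_towerNumber`, `not_hyperLinLiouville_sq_towerNumber`)

(lens-1 g33 `RootDecomp1KFiniteOrderCell.lean`, sha256 7ddcd064f55911e6…, farm rc 0 · 0 warn · 0 sorry · axioms std; critic VERDICT STATUS L1611: ONE cell-decision credit «33364 FIRST CELL» (K-R15), PORT GO LOW census lane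
`--supports stmt-Schanuel-33364`; port by census-1 gen 14 in four parts RootDecomp1KFiniteOrderCell01–04 (§1 = the verbatim copy of the g32 engine DELETED, engine imported from the landed `RootDecomp1PowerLineOrder02`;
`set_option linter.*` dropped; 14 one-line docstrings added); statements and proofs verbatim; binders hNW1 / hNW by name. Nothing here proves Schanuel; rung 0.)
-/

noncomputable section

open Complex IntermediateField Filter Polynomial

namespace Summit.Schanuel.Schanuel.Theorems.RootDecomp1KFiniteOrderCell

open Summit.Schanuel.Schanuel.Theorems.RootDecomp1KHyper
open Summit.Schanuel.Schanuel.Theorems.RootDecomp1KHyper.HyperCell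
open Summit.Schanuel.Schanuel.Theorems.RootDecomp1KGeneric (LiouvilleOrder LogSqLiouville)
open Literature.NumberTheory.Transcendental (NesterenkoWaldschmidt1996_thm_5_1 NesterenkoWaldschmidt1996_thm_1)
open Summit.Schanuel.Schanuel.Theorems.RootDecomp1PowerLineLadder (sb_momentCurve_of_liouvilleOrder)

variable {n K : ℕ}

/-! ## §4  A degree-`n` NON-MEASURE: the moment curve of `T_c` (`c ≥ n + 1`) is not hyper-Liouville

For `P(x) = Σ_{k<n} h_k x^{k+1}`, `h ∈ ℤⁿ ∖ 0`, `S = Σ|h_k|`, pick the least scale `i` with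
`Q_i = 2^{a_i} > 4nS`.  The truncation `s_i = M/Q_i` (`M` odd) is NOT a root of `P` (else `Q_i ∣ h_top`,
divisibility lemma), so `|P(s_i)| ≥ Q_i^{−n}`; `|P(T_c) − P(s_i)| ≤ nS·(T_c − s_i) ≤ 2nS/Q_{i+1}` and
`Q_{i+1} = 2^{Q_i^c} ≥ Q_i^{n+1} > 4nS·Q_i^n`; so `|P(T_c)| ≥ 1/(2Q_i^n) ≥ 2^{−(1 + n(4nS)^c)} ≥
exp(−(1+S)^{c+(n+2)(c+1)})` — ONE exponent `m = c + (n+2)(c+1)` at which the hyper bound fails for all `h`. -/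

/-- `0 ≤ x^j − y^j ≤ j·(x − y)` for `0 ≤ y ≤ x ≤ 1`. -/
private theorem pow_sub_pow_unit {x y : ℝ} (hy : 0 ≤ y) (hyx : y ≤ x) (hx : x ≤ 1) (j : ℕ) :
    0 ≤ x ^ j - y ^ j ∧ x ^ j - y ^ j ≤ (j : ℝ) * (x - y) := by
  induction j with
  | zero => simp
  | succ j ih =>
      obtain ⟨ih0, ih1⟩ := ih
      have hx0 : 0 ≤ x := hy.trans hyx
      have hyj : y ^ j ≤ 1 := pow_le_one₀ hy (hyx.trans hx)
      have hyj0 : 0 ≤ y ^ j := pow_nonneg hy j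
      have e : x ^ (j + 1) - y ^ (j + 1) = x * (x ^ j - y ^ j) + (x - y) * y ^ j := by ring
      rw [e]
      refine ⟨add_nonneg (mul_nonneg hx0 ih0) (mul_nonneg (sub_nonneg.mpr hyx) hyj0), ?_⟩
      have h1 : x * (x ^ j - y ^ j) ≤ x ^ j - y ^ j := mul_le_of_le_one_left ih0 hx
      have h2 : (x - y) * y ^ j ≤ x - y := mul_le_of_le_one_right (sub_nonneg.mpr hyx) hyj
      push_cast
      linarith

/-- **Divisibility lemma.** If an integer combination `Σ_{k<n} h_k (M/2^a)^{k+1}` (`M` odd, `h ≠ 0`)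
VANISHES then `2^a` divides the top non-zero coefficient: some `h_k ≠ 0` has `|h_k| ≥ 2^a`. -/
private theorem exists_large_coeff_of_sum_eq_zero (n : ℕ) :
    ∀ (h : Fin n → ℤ), h ≠ 0 → ∀ {M a : ℕ}, Odd M →
      ∑ k : Fin n, (h k : ℝ) * ((M : ℝ) / (2 : ℝ) ^ a) ^ ((k : ℕ) + 1) = 0 →
      ∃ k, h k ≠ 0 ∧ 2 ^ a ≤ (h k).natAbs := by
  induction n with
  | zero => intro h hh; exact absurd (Subsingleton.elim h 0) hh
  | succ n ih =>
      intro h hh M a hM hsum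
      rw [Fin.sum_univ_castSucc] at hsum
      simp only [Fin.val_castSucc, Fin.val_last] at hsum
      by_cases hlast : h (Fin.last n) = 0
      · -- descend to the first `n` coefficients
        have hh' : (fun k : Fin n => h (Fin.castSucc k)) ≠ 0 := by
          intro h0
          apply hh
          funext k
          refine Fin.lastCases ?_ (fun j => ?_) k
          · simpa using hlast
          · simpa using congrFun h0 j
        rw [hlast, Int.cast_zero, zero_mul, add_zero] at hsum
        obtain ⟨j, hj, hle⟩ := ih (fun k : Fin n => h (Fin.castSucc k)) hh' hM hsum
        exact ⟨Fin.castSucc j, hj, hle⟩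
      · -- clear denominators: `2^a · N + h_n · M^{n+1} = 0` over ℤ
        have hQ0 : (2 : ℝ) ^ a ≠ 0 := by positivity
        have hterm : ∀ k : Fin n, ((2 : ℝ) ^ a) ^ (n + 1) * ((h (Fin.castSucc k) : ℝ) *
            ((M : ℝ) / (2 : ℝ) ^ a) ^ ((k : ℕ) + 1)) =
            (2 : ℝ) ^ a * ((h (Fin.castSucc k) : ℝ) * (M : ℝ) ^ ((k : ℕ) + 1) *
              ((2 : ℝ) ^ a) ^ (n - 1 - (k : ℕ))) := by
          intro k
          have hk : (k : ℕ) < n := k.isLt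
          have hd : n + 1 = ((k : ℕ) + 1) + (1 + (n - 1 - (k : ℕ))) := by omega
          rw [hd, pow_add, pow_add, pow_one, div_pow]
          field_simp
          ring
        have hlastR : ((2 : ℝ) ^ a) ^ (n + 1) * ((h (Fin.last n) : ℝ) *
            ((M : ℝ) / (2 : ℝ) ^ a) ^ (n + 1)) = (h (Fin.last n) : ℝ) * (M : ℝ) ^ (n + 1) := by
          rw [div_pow]; field_simp
        have hreal : (2 : ℝ) ^ a * (∑ k : Fin n, (h (Fin.castSucc k) : ℝ) * (M : ℝ) ^ ((k : ℕ) + 1) *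
            ((2 : ℝ) ^ a) ^ (n - 1 - (k : ℕ))) + (h (Fin.last n) : ℝ) * (M : ℝ) ^ (n + 1) = 0 := by
          have e := congrArg (fun t => ((2 : ℝ) ^ a) ^ (n + 1) * t) hsum
          simp only [mul_add, mul_zero, Finset.mul_sum] at e
          rw [Finset.sum_congr rfl (fun k _ => hterm k), hlastR, ← Finset.mul_sum] at e
          exact e
        set N : ℤ := ∑ k : Fin n, h (Fin.castSucc k) * (M : ℤ) ^ ((k : ℕ) + 1) *
          ((2 : ℤ) ^ a) ^ (n - 1 - (k : ℕ)) with hN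
        have hint : (2 : ℤ) ^ a * N + h (Fin.last n) * (M : ℤ) ^ (n + 1) = 0 := by
          have : (((2 : ℤ) ^ a * N + h (Fin.last n) * (M : ℤ) ^ (n + 1) : ℤ) : ℝ) = 0 := by
            rw [← hreal, hN]; push_cast; rfl
          exact_mod_cast this
        have hdvd : (2 : ℤ) ^ a ∣ h (Fin.last n) * (M : ℤ) ^ (n + 1) :=
          ⟨-N, by linear_combination hint⟩
        have hdvdN : 2 ^ a ∣ (h (Fin.last n)).natAbs * M ^ (n + 1) := by
          have := Int.natAbs_dvd_natAbs.mpr hdvd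
          simpa [Int.natAbs_mul, Int.natAbs_pow] using this
        have hcop : Nat.Coprime (2 ^ a) (M ^ (n + 1)) :=
          Nat.Coprime.pow a (n + 1) (Nat.coprime_two_left.mpr hM)
        exact ⟨Fin.last n, hlast,
          Nat.le_of_dvd (Int.natAbs_pos.mpr hlast) (hcop.dvd_of_dvd_mul_right hdvdN)⟩

/-- `Q^n · (M/Q)^{k+1} = M^{k+1} · Q^{n−1−k}` for `k < n`. -/
private theorem clear_denom {Q : ℝ} (hQ : Q ≠ 0) (M : ℝ) {k n : ℕ} (hk : k < n) :
    Q ^ n * (M / Q) ^ (k + 1) = M ^ (k + 1) * Q ^ (n - 1 - k) := by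
  obtain ⟨d, hd⟩ : ∃ d, n = k + 1 + d := ⟨n - (k + 1), by omega⟩
  have hd' : n - 1 - k = d := by omega
  rw [hd', hd, pow_add, div_pow]
  field_simp

/-- The bookkeeping behind the exponent `m = c + (n+2)(c+1)`: `1 + n(4nS)^c ≤ (1+S)^m`. -/
private theorem bookkeeping (n c S : ℕ) (hS : 1 ≤ S) :
    1 + n * (4 * n * S) ^ c ≤ (1 + S) ^ (c + (n + 2) * (c + 1)) := by
  have h1 : n ≤ 2 ^ n := Nat.lt_two_pow_self.le
  have h4 : S ^ c ≤ (1 + S) ^ c := Nat.pow_le_pow_left (by omega) c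
  have h5 : 1 ≤ (1 + S) ^ c := Nat.one_le_pow _ _ (by omega)
  have h6 : 2 ^ ((n + 2) * (c + 1)) ≤ (1 + S) ^ ((n + 2) * (c + 1)) :=
    Nat.pow_le_pow_left (by omega) _
  have h7 : n * (4 ^ c * n ^ c) ≤ 2 ^ (n + 2 * c + n * c) := by
    have e4 : 4 ^ c = 2 ^ (2 * c) := by rw [pow_mul]; norm_num
    have e5 : (2 ^ n) ^ c = 2 ^ (n * c) := (pow_mul 2 n c).symm
    calc n * (4 ^ c * n ^ c) ≤ 2 ^ n * (4 ^ c * (2 ^ n) ^ c) := by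
          gcongr
      _ = 2 ^ (n + 2 * c + n * c) := by rw [e4, e5, pow_add, pow_add]; ring
  have h8 : 1 + 2 ^ (n + 2 * c + n * c) ≤ 2 ^ ((n + 2) * (c + 1)) := by
    have hle : n + 2 * c + n * c + 1 ≤ (n + 2) * (c + 1) := by nlinarith
    calc 1 + 2 ^ (n + 2 * c + n * c) ≤ 2 ^ (n + 2 * c + n * c) + 2 ^ (n + 2 * c + n * c) := by
          have := Nat.one_le_two_pow (n := n + 2 * c + n * c); omega
      _ = 2 ^ (n + 2 * c + n * c + 1) := by rw [pow_succ]; ring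
      _ ≤ 2 ^ ((n + 2) * (c + 1)) := Nat.pow_le_pow_right (by norm_num) hle
  have h9 : n * (4 ^ c * n ^ c) * S ^ c ≤ 2 ^ (n + 2 * c + n * c) * (1 + S) ^ c :=
    Nat.mul_le_mul h7 h4
  calc 1 + n * (4 * n * S) ^ c = 1 + n * (4 ^ c * n ^ c) * S ^ c := by rw [mul_pow, mul_pow]; ring
    _ ≤ (1 + S) ^ c + 2 ^ (n + 2 * c + n * c) * (1 + S) ^ c := Nat.add_le_add h5 h9
    _ = (1 + 2 ^ (n + 2 * c + n * c)) * (1 + S) ^ c := by ring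
    _ ≤ 2 ^ ((n + 2) * (c + 1)) * (1 + S) ^ c := Nat.mul_le_mul_right _ h8
    _ ≤ (1 + S) ^ ((n + 2) * (c + 1)) * (1 + S) ^ c := Nat.mul_le_mul_right _ h6
    _ = (1 + S) ^ (c + (n + 2) * (c + 1)) := by rw [← pow_add]; ring_nf

/-- **The moment curve `(T_c, T_c², …, T_cⁿ)` is NOT a hyper-Liouville point** (`c ≥ 2`, `c ≥ n + 1`):
an effective degree-`n` NON-measure for the tower number, at the single exponent `m = c + (n+2)(c+1)`. -/
theorem not_hyperLinLiouville_momentCurve_towerNumber {c n : ℕ} (hc : 2 ≤ c) (hcn : n + 1 ≤ c) :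
    ¬ HyperLinLiouville (fun i : Fin n => ((towerNumber c : ℝ) : ℂ) ^ ((i : ℕ) + 1)) := by
  classical
  have hc1 : 1 ≤ c := by omega
  intro hH
  obtain ⟨h, hh, hlt⟩ := hH (c + (n + 2) * (c + 1))
  -- `n ≥ 1`
  have hn : 0 < n := by
    rcases Nat.eq_zero_or_pos n with h0 | h0
    · subst h0; exact absurd (Subsingleton.elim h 0) hh
    · exact h0
  have hnR : (0 : ℝ) < n := by exact_mod_cast hn
  -- the linear form is the real polynomial value `P(T_c)`
  set ℓ : ℝ := towerNumber c with hℓdef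
  set P : ℝ → ℝ := fun x => ∑ k : Fin n, (h k : ℝ) * x ^ ((k : ℕ) + 1) with hP
  have hnorm : ‖∑ i : Fin n, (h i : ℂ) * ((ℓ : ℂ) ^ ((i : ℕ) + 1))‖ = |P ℓ| := by
    have e : (∑ i : Fin n, (h i : ℂ) * ((ℓ : ℂ) ^ ((i : ℕ) + 1))) = ((P ℓ : ℝ) : ℂ) := by
      simp only [hP]; push_cast; rfl
    rw [e, Complex.norm_real, Real.norm_eq_abs]
  rw [hnorm] at hlt
  -- `S = Σ|h_i|` as a natural number
  set S : ℕ := ∑ i, (h i).natAbs with hSdef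
  have hScast : (S : ℝ) = ∑ i, (|h i| : ℝ) := by
    rw [hSdef, Nat.cast_sum]
    simp only [Nat.cast_natAbs, Int.cast_abs]
  have hS1R : (1 : ℝ) ≤ S := by rw [hScast]; exact one_le_hsum hh
  have hS1 : 1 ≤ S := by exact_mod_cast hS1R
  have hSR : (0 : ℝ) < S := by linarith
  have hkS : ∀ k, (h k).natAbs ≤ S := fun k =>
    Finset.single_le_sum (f := fun j => (h j).natAbs) (fun j _ => Nat.zero_le _) (Finset.mem_univ k)
  -- the scale: the least `i` with `Q_i = 2^{a_i} > 4nS`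
  have hex : ∃ i : ℕ, 4 * n * S < 2 ^ texp c i :=
    ⟨4 * n * S, lt_of_lt_of_le Nat.lt_two_pow_self (Nat.pow_le_pow_right (by norm_num)
      ((Nat.le_succ _).trans (succ_le_texp hc1 _)))⟩
  obtain ⟨i, hiP, hmin⟩ : ∃ i : ℕ, 4 * n * S < 2 ^ texp c i ∧ ∀ j < i, ¬ 4 * n * S < 2 ^ texp c j :=
    ⟨Nat.find hex, Nat.find_spec hex, fun j hj => Nat.find_min hex hj⟩
  -- `Q_i ≤ 2^{(4nS)^c}` by minimality
  have hQle : 2 ^ texp c i ≤ 2 ^ ((4 * n * S) ^ c) := by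
    rcases Nat.eq_zero_or_pos i with hi0 | hipos
    · rw [hi0, texp_zero]
      exact Nat.pow_le_pow_right (n := 2) (by norm_num)
        (Nat.one_le_pow c (4 * n * S) (Nat.mul_pos (Nat.mul_pos (by norm_num) hn) (by omega)))
    · obtain ⟨i', rfl⟩ : ∃ i', i = i' + 1 := ⟨i - 1, by omega⟩
      have hle : 2 ^ texp c i' ≤ 4 * n * S := not_lt.mp (hmin i' (by omega))
      rw [texp_succ_eq_pow]
      exact Nat.pow_le_pow_right (by norm_num) (Nat.pow_le_pow_left hle c)
  -- the truncation `s = M/Q` and the tail `T`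
  obtain ⟨M, hModd, hsumM⟩ := towerNumber_partialSum hc1 i
  set Q : ℝ := (2 : ℝ) ^ texp c i with hQdef
  have hQpos : 0 < Q := by positivity
  set s : ℝ := (M : ℝ) / Q with hsdef
  set T : ℝ := ∑' k, 1 / (2 : ℝ) ^ texp c (k + (i + 1)) with hTdef
  have hℓsT : ℓ = s + T := by
    rw [hℓdef, towerNumber_eq_partialSum_add_tail hc1 (i + 1), hsumM]
  have hTpos : 0 < T := towerNumber_tail_pos hc1 (i + 1)
  have hTle : T ≤ 2 * (1 / (2 : ℝ) ^ texp c (i + 1)) := towerNumber_tail_le hc1 (i + 1)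
  -- (1) `P(s) ≠ 0`, indeed `|P(s)| ≥ 1/Q^n`
  have hPs_ne : P s ≠ 0 := by
    intro h0
    have h0' : ∑ k : Fin n, (h k : ℝ) * ((M : ℝ) / (2 : ℝ) ^ texp c i) ^ ((k : ℕ) + 1) = 0 := by
      simpa [hP, hsdef, hQdef] using h0
    obtain ⟨k, -, hle⟩ := exists_large_coeff_of_sum_eq_zero n h hh hModd h0'
    have h1 : (h k).natAbs ≤ 4 * n * S :=
      (hkS k).trans (Nat.le_mul_of_pos_left S (by omega))
    omega
  have hPs : 1 / Q ^ n ≤ |P s| := by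
    set Z : ℤ := ∑ k : Fin n, h k * (M : ℤ) ^ ((k : ℕ) + 1) *
      ((2 : ℤ) ^ texp c i) ^ (n - 1 - (k : ℕ)) with hZ
    have hZreal : (Z : ℝ) = Q ^ n * P s := by
      simp only [hZ, hP, hsdef, Finset.mul_sum]
      push_cast
      refine Finset.sum_congr rfl fun k _ => ?_
      rw [mul_left_comm, clear_denom hQpos.ne' (M : ℝ) k.isLt]
      ring
    have hZne : Z ≠ 0 := by
      intro h0
      have : Q ^ n * P s = 0 := by rw [← hZreal, h0, Int.cast_zero]
      rcases mul_eq_zero.mp this with h1 | h1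
      · exact absurd h1 (by positivity)
      · exact hPs_ne h1
    have h1 : (1 : ℝ) ≤ |(Z : ℝ)| := by exact_mod_cast Int.one_le_abs hZne
    rw [hZreal, abs_mul, abs_of_pos (by positivity : (0 : ℝ) < Q ^ n)] at h1
    rw [div_le_iff₀ (by positivity), mul_comm]
    exact h1
  -- (2) `|P(T_c) − P(s)| ≤ n·S·T`
  have hs0 : 0 ≤ s := by positivity
  have hsℓ : s ≤ ℓ := by rw [hℓsT]; linarith
  have hℓ1 : ℓ ≤ 1 := towerNumber_le_one hc1
  have hℓs : ℓ - s = T := by rw [hℓsT]; ring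
  have hdiff : |P ℓ - P s| ≤ n * S * T := by
    have e : P ℓ - P s = ∑ k : Fin n, (h k : ℝ) * (ℓ ^ ((k : ℕ) + 1) - s ^ ((k : ℕ) + 1)) := by
      simp only [hP, ← Finset.sum_sub_distrib]
      exact Finset.sum_congr rfl fun k _ => by ring
    rw [e]
    calc |∑ k : Fin n, (h k : ℝ) * (ℓ ^ ((k : ℕ) + 1) - s ^ ((k : ℕ) + 1))|
        ≤ ∑ k : Fin n, |(h k : ℝ) * (ℓ ^ ((k : ℕ) + 1) - s ^ ((k : ℕ) + 1))| :=
          Finset.abs_sum_le_sum_abs _ _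
      _ ≤ ∑ k : Fin n, (|h k| : ℝ) * (n * T) := by
          refine Finset.sum_le_sum fun k _ => ?_
          rw [abs_mul]
          refine mul_le_mul_of_nonneg_left ?_ (abs_nonneg _)
          obtain ⟨h0, h1⟩ := pow_sub_pow_unit hs0 hsℓ hℓ1 ((k : ℕ) + 1)
          rw [abs_of_nonneg h0]
          have hk1 : (((k : ℕ) + 1 : ℕ) : ℝ) ≤ n := by exact_mod_cast Nat.succ_le_of_lt k.isLt
          calc ℓ ^ ((k : ℕ) + 1) - s ^ ((k : ℕ) + 1) ≤ (((k : ℕ) + 1 : ℕ) : ℝ) * (ℓ - s) := h1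
            _ ≤ n * T := by rw [hℓs]; exact mul_le_mul_of_nonneg_right hk1 hTpos.le
      _ = n * S * T := by rw [← Finset.sum_mul, ← hScast]; ring
  -- (3) `n·S·T ≤ 1/(2Q^n)` since `Q_{i+1} = 2^{Q_i^c} ≥ Q_i^{n+1} > 4nS·Q_i^n`
  have hnext : (4 * n * S : ℝ) * Q ^ n ≤ (2 : ℝ) ^ texp c (i + 1) := by
    have h1 : 4 * n * S * (2 ^ texp c i) ^ n ≤ 2 ^ texp c (i + 1) := by
      rw [texp_succ_eq_pow]
      have hQ1 : 0 < 2 ^ texp c i := by positivity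
      calc 4 * n * S * (2 ^ texp c i) ^ n ≤ 2 ^ texp c i * (2 ^ texp c i) ^ n :=
            Nat.mul_le_mul_right _ hiP.le
        _ = (2 ^ texp c i) ^ (n + 1) := by ring
        _ ≤ (2 ^ texp c i) ^ c := Nat.pow_le_pow_right hQ1 hcn
        _ ≤ 2 ^ ((2 ^ texp c i) ^ c) := Nat.lt_two_pow_self.le
    have h2 : ((4 * n * S * (2 ^ texp c i) ^ n : ℕ) : ℝ) ≤ ((2 ^ texp c (i + 1) : ℕ) : ℝ) := by
      exact_mod_cast h1
    push_cast at h2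
    simpa [hQdef] using h2
  have hstep3 : (n : ℝ) * S * T ≤ 1 / (2 * Q ^ n) := by
    have hnS : (0 : ℝ) ≤ (n : ℝ) * S := by positivity
    calc (n : ℝ) * S * T ≤ (n : ℝ) * S * (2 * (1 / (2 : ℝ) ^ texp c (i + 1))) :=
          mul_le_mul_of_nonneg_left hTle hnS
      _ = 2 * ((n : ℝ) * S) / (2 : ℝ) ^ texp c (i + 1) := by ring
      _ ≤ 2 * ((n : ℝ) * S) / (4 * n * S * Q ^ n) :=
          div_le_div_of_nonneg_left (by positivity) (by positivity) hnext
      _ = 1 / (2 * Q ^ n) := by field_simp; ring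
  -- (4) so `|P(T_c)| ≥ 1/(2Q^n)`
  have hPℓ : 1 / (2 * Q ^ n) ≤ |P ℓ| := by
    have ha := abs_sub_abs_le_abs_sub (P s) (P ℓ)
    have hb : |P s - P ℓ| = |P ℓ - P s| := abs_sub_comm _ _
    have e : 1 / Q ^ n = 2 * (1 / (2 * Q ^ n)) := by field_simp
    linarith
  -- (5) … while the hyper bound at `m` is below `1/(2Q^n)`:
  --     `2Q^n ≤ 2^{1 + n(4nS)^c} ≤ 2^{(1+S)^m} ≤ exp((1+S)^m)`
  have hfinal : Real.exp (-((1 + ∑ i, (|h i| : ℝ)) ^ (c + (n + 2) * (c + 1)))) ≤ 1 / (2 * Q ^ n) := by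
    have hScast' : (1 + ∑ i, (|h i| : ℝ)) = ((1 + S : ℕ) : ℝ) := by rw [← hScast]; push_cast; ring
    rw [hScast', Real.exp_neg, ← one_div]
    have hQle' : Q ≤ (2 : ℝ) ^ ((4 * n * S) ^ c) := by rw [hQdef]; exact_mod_cast hQle
    have h1 : 2 * Q ^ n ≤ (2 : ℝ) ^ (1 + n * (4 * n * S) ^ c) := by
      rw [pow_add, pow_one, pow_mul']
      gcongr
    have h2 : (2 : ℝ) ^ (1 + n * (4 * n * S) ^ c) ≤ (2 : ℝ) ^ ((1 + S) ^ (c + (n + 2) * (c + 1))) :=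
      pow_le_pow_right₀ (by norm_num) (bookkeeping n c S hS1)
    have h3 : (2 : ℝ) ^ ((1 + S) ^ (c + (n + 2) * (c + 1))) ≤
        Real.exp (((1 + S : ℕ) : ℝ) ^ (c + (n + 2) * (c + 1))) := by
      have h2e : (2 : ℝ) ≤ Real.exp 1 := by linarith [Real.add_one_le_exp (1 : ℝ)]
      calc (2 : ℝ) ^ ((1 + S) ^ (c + (n + 2) * (c + 1)))
          ≤ (Real.exp 1) ^ ((1 + S) ^ (c + (n + 2) * (c + 1))) := pow_le_pow_left₀ (by norm_num) h2e _
        _ = Real.exp (((1 + S : ℕ) : ℝ) ^ (c + (n + 2) * (c + 1))) := by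
            rw [← Real.exp_nat_mul]; push_cast; ring_nf
    exact one_div_le_one_div_of_le (by positivity) (h1.trans (h2.trans h3))
  linarith [hfinal, hPℓ, hlt]

/-- In particular (`c ≥ 3`): the PAIR `(T_c, T_c²)` is not hyper-Liouville — consistent with, and for
`c ≥ 3` independent of, the tree's `not_hyperLinLiouville_of_ratio_not_hyperLiouville`. -/
theorem not_hyperLinLiouville_sq_towerNumber {c : ℕ} (hc : 3 ≤ c) :
    ¬ HyperLinLiouville (fun i : Fin 2 => ((towerNumber c : ℝ) : ℂ) ^ ((i : ℕ) + 1)) :=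
  not_hyperLinLiouville_momentCurve_towerNumber (by omega) (by omega)

end Summit.Schanuel.Schanuel.Theorems.RootDecomp1KFiniteOrderCell
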